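import Summits.Ventures.CertifiedManyBodySolver.Upper.StripCellWords

/-!
# The open Hubbard strip in column-major order, III: the blocked Hamiltonian and the cell bond matrix

HONEST FRAMING: first certified bounds; not a superconductivity verdict; every number certified or
labelled float.

Venture `Ventures/CertifiedManyBodySolver` (sr-mbsolver), K1-GATE «writer (ii)» piece (α) of the route pen's
`WRITER-II-SPEC.md` §1, STRIP PART 3/3 (parts 1–2: `Upper/StripCells.lean`, `Upper/StripCellWords.lean`;
generic blocking: `Upper/SuperSiteBlocking.lean`). THE PRESENTATION the uMPS tensor side consumes
(`Upper/UMPSDualBound.lean`, `re_sum_star_mpsOpen_dotProduct_bondSum_mulVec_le` with super-sites = cells,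
`q = 4^{c·W}`), for ANY enumeration `κ` of the cell configurations:

* `superOp_hoppingSum` — the hopping words of the big box, blocked (cell words + inter-cell words);
* **`superOp_toSpin_hubbardOpenBoxTT'`** — `superOp (toSpin H_open((C·c) × W; t, 0, U)) =
  Σ_b onSite b (superSite κ (toSpin H_open(c × W))) − t Σ_{b+1=b'} Σ_{y₀,σ} (L_b R_{b'} + L'_b R'_{b'})`;
  `superOp_sum_onSite_siteTotalNumber`, `superOp_toSpin_totalNumber` — the particle number, cell by cell;
* `interCellMatrix κ hc t`, **`stripCellBondMatrix κ hc t U = superSite κ (toSpin H_open(c × W)) ⊗ 1 + interCellMatrix`**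
  — the cell bond matrix `hh` of the strip (intra-cell energy of the LEFT cell + coupling; the strip analogue of
  `cellBondMatrix` of `Upper/UMPSCellBondMatrix.lean`), `bondSum_interCellMatrix`;
* **`superOp_toSpin_hubbardOpenBoxTT'_eq_bondSum`** — on `n + 2` cells:
  `superOp (toSpin H) = bondSum n (stripCellBondMatrix κ hc t U) + onSite (last cell) (superSite κ (toSpin H_cell))`.

With `Upper/SuperSiteBlocking.star_comp_superCfg_dotProduct_mulVec` this turns the sink's spin-side energy
`Re⟨φ, toSpin H φ⟩` for `φ = ψ ∘ superCfg` into `Re⟨ψ, (bondSum n hh + last) ψ⟩` on the cell chain. Not here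
(successor files of writer (ii)): the tensor side at `q = 4^{c·W}`, the charge identity (γ), the last-cell
bookkeeping constant, the assembly into `m3Upper_tp0_le_m18o25_of_columnMajorSpinFamily`; `t' ≠ 0`.
References: route pen's `WRITER-II-SPEC.md` §1; LeBlanc et al., PRX 5 (2015) 041041, eq. (1); Essler et al.
(2005) §12.3.4.
-/

noncomputable section

open Matrix Finset
open scoped ComplexOrder BigOperators Kronecker

namespace Summit.Ventures.CertifiedManyBodySolver.Upper

open Literature.MathematicalPhysics.QuantumLattice
open Literature.MathematicalPhysics.QuantumLattice.JordanWigner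

/-! ### The blocked Hamiltonian -/

section Hamiltonian

variable {C c W Q : ℕ}

/-- At `t' = 0` the open-box `t–t'` Hamiltonian is the Hubbard Hamiltonian of the open-box graph. -/
theorem hubbardOpenBoxTT'_tPrime_zero (a b : ℕ) (t U : ℝ) :
    hubbardOpenBoxTT' a b t 0 U = hamiltonian (rectBoxGraph a b) t U := by
  simp [hubbardOpenBoxTT', hamiltonian]

/-- `onSite b 0 = 0`. -/
theorem onSite_zero_eq {B : Type*} [Fintype B] [DecidableEq B] (b : B) :
    (onSite b (0 : Matrix (Fin Q) (Fin Q) ℂ) : Op B Q) = 0 := by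
  ext σ τ
  simp only [onSite_apply, Matrix.zero_apply]
  split_ifs <;> rfl

/-- **The hopping words of the `(C·c) × W` box, blocked**: the words of the bonds inside a cell block to
that cell's own hopping words (as a one-cell operator), the words of the bonds between consecutive cells
to the products of the inter-cell half-words. -/
theorem superOp_hoppingSum (hc : 0 < c) (κ : TensorIndex (Fin c ×ₗ Fin W) 4 ≃ Fin Q) :
    superOp (stripCells C c W) κ
        (∑ p, ∑ q, ∑ σ : Fin 2, if (rectBoxGraph (C * c) W).Adj p q then
          onSite p (siteCreation σ) * (jwString p * jwString q) * onSite q (siteAnnihilation σ) else 0) =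
      ∑ b : Fin C, onSite b (superSite κ
        (∑ f, ∑ f', ∑ σ : Fin 2, if (rectBoxGraph c W).Adj f f' then
          onSite f (siteCreation σ) * (jwString f * jwString f') * onSite f' (siteAnnihilation σ) else 0)) +
      ∑ b : Fin C, ∑ b' : Fin C, if (b : ℕ) + 1 = b' then ∑ y₀ : Fin W, ∑ σ : Fin 2,
        (onSite b (superSite κ (productOp (interLeftFamily hc y₀ (siteCreation σ * siteParity)))) *
            onSite b' (superSite κ (productOp (interRightFamily hc y₀ (siteAnnihilation σ)))) +
          onSite b (superSite κ (productOp (interLeftFamily hc y₀ (siteParity * siteAnnihilation σ)))) *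
            onSite b' (superSite κ (productOp (interRightFamily hc y₀ (siteCreation σ))))) else 0 := by
  simp only [Finset.sum_ite_irrel, Finset.sum_const_zero]
  rw [sum_sum_ite_rectBoxGraph_adj_cells hc, map_add]
  congr 1
  · rw [map_sum]
    refine Finset.sum_congr rfl fun b _ => ?_
    rw [map_sum, map_sum, onSite_sum_eq]
    refine Finset.sum_congr rfl fun f _ => ?_
    rw [map_sum, map_sum, onSite_sum_eq]
    refine Finset.sum_congr rfl fun f' _ => ?_
    by_cases hff' : (rectBoxGraph c W).Adj f f'
    · rw [if_pos hff', if_pos hff', map_sum, map_sum, onSite_sum_eq]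
      refine Finset.sum_congr rfl fun σ _ => ?_
      have hne : f ≠ f' := hff'.ne
      have hne' : (stripCells C c W).symm (b, f) ≠ (stripCells C c W).symm (b, f') := fun h =>
        hne ((stripCells_symm_eq_iff b b f f').mp h).2
      rw [onSite_mul_jwString_mul_jwString_mul_onSite hne', onSite_mul_jwString_mul_jwString_mul_onSite hne]
      have h := superOp_productOp_jwWordFamily_cell (stripCells C c W) κ b (cellEmb C c W b) (fun _ => rfl)
        (ordConnected_range_cellEmb b) f f' (siteCreation σ) (siteAnnihilation σ)
      simpa only [cellEmb_apply] using h
    · rw [if_neg hff', if_neg hff', map_zero, map_zero, onSite_zero_eq]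
  · rw [map_sum]
    refine Finset.sum_congr rfl fun b _ => ?_
    rw [map_sum]
    refine Finset.sum_congr rfl fun b' _ => ?_
    by_cases hbb' : (b : ℕ) + 1 = b'
    · rw [if_pos hbb', if_pos hbb', map_sum]
      refine Finset.sum_congr rfl fun y₀ _ => ?_
      rw [map_add, map_sum, map_sum, Finset.sum_add_distrib]
      have hb : b < b' := by rw [Fin.lt_def]; omega
      have hxy := stripCells_symm_lt_of_lt hb (toLex (⟨c - 1, by omega⟩, y₀)) (toLex ((⟨0, hc⟩ : Fin c), y₀))
      congr 1 <;> refine Finset.sum_congr rfl fun σ _ => ?_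
      · rw [onSite_mul_jwString_mul_jwString_mul_onSite hxy.ne, superOp_productOp_jwWordFamily_inter hc κ hbb']
      · rw [onSite_mul_jwString_mul_jwString_mul_onSite hxy.ne',
          superOp_productOp_jwWordFamily_inter' hc κ hbb']
    · rw [if_neg hbb', if_neg hbb', map_zero]

/-- **The open `(C·c) × W` Hubbard box (`t' = 0`) in column-major Jordan–Wigner form, blocked into `C`
cells of `c` columns**: the sum of the cells' own `c × W` open-box Hamiltonians (one-cell operators) and,
for consecutive cells, the inter-cell hopping words. Any enumeration `κ` of the cell configurations. -/
theorem superOp_toSpin_hubbardOpenBoxTT' (hc : 0 < c) (κ : TensorIndex (Fin c ×ₗ Fin W) 4 ≃ Fin Q)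
    (t U : ℝ) :
    superOp (stripCells C c W) κ (toSpin (hubbardOpenBoxTT' (C * c) W t 0 U)) =
      ∑ b : Fin C, onSite b (superSite κ (toSpin (hubbardOpenBoxTT' c W t 0 U))) +
      (-(t : ℂ)) • ∑ b : Fin C, ∑ b' : Fin C, if (b : ℕ) + 1 = b' then ∑ y₀ : Fin W, ∑ σ : Fin 2,
        (onSite b (superSite κ (productOp (interLeftFamily hc y₀ (siteCreation σ * siteParity)))) *
            onSite b' (superSite κ (productOp (interRightFamily hc y₀ (siteAnnihilation σ)))) +
          onSite b (superSite κ (productOp (interLeftFamily hc y₀ (siteParity * siteAnnihilation σ)))) *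
            onSite b' (superSite κ (productOp (interRightFamily hc y₀ (siteCreation σ))))) else 0 := by
  rw [hubbardOpenBoxTT'_tPrime_zero, hubbardOpenBoxTT'_tPrime_zero, toSpin_hamiltonian, toSpin_hamiltonian,
    map_add, map_smul, map_smul, superOp_hoppingSum hc κ, smul_add,
    superOp_sum_onSite (stripCells C c W) κ (fun _ => siteDouble)]
  simp only [map_add, map_smul, onSite_add', onSite_smul', Finset.sum_add_distrib]
  rw [← Finset.smul_sum, ← Finset.smul_sum]
  abel

/-- **The particle number blocks cell by cell**: `superOp (Σ_x (n_↑+n_↓)_x) = Σ_b onSite b (superSite (Σ_f (n_↑+n_↓)_f))`. -/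
theorem superOp_sum_onSite_siteTotalNumber (κ : TensorIndex (Fin c ×ₗ Fin W) 4 ≃ Fin Q) :
    superOp (stripCells C c W) κ (∑ x : Fin (C * c) ×ₗ Fin W, onSite x siteTotalNumber) =
      ∑ b : Fin C, onSite b (superSite κ (∑ f : Fin c ×ₗ Fin W, onSite f siteTotalNumber)) :=
  superOp_sum_onSite _ κ fun _ => siteTotalNumber

/-- The same for `toSpin N̂`. -/
theorem superOp_toSpin_totalNumber (κ : TensorIndex (Fin c ×ₗ Fin W) 4 ≃ Fin Q) :
    superOp (stripCells C c W) κ (toSpin (totalNumber (Λ := Fin (C * c) ×ₗ Fin W))) =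
      ∑ b : Fin C, onSite b (superSite κ (toSpin (totalNumber (Λ := Fin c ×ₗ Fin W)))) := by
  rw [toSpin_totalNumber (Λ := Fin (C * c) ×ₗ Fin W), toSpin_totalNumber (Λ := Fin c ×ₗ Fin W)]
  exact superOp_sum_onSite _ κ fun _ => siteTotalNumber

/-! ### The cell bond matrix and the `bondSum` form -/

/-- **The inter-cell coupling** of the strip as a matrix on (cell) ⊗ (cell):
`-t Σ_{y₀, σ} (L_{y₀σ} ⊗ R_{y₀σ} + L'_{y₀σ} ⊗ R'_{y₀σ})` with the half-words of `interLeftFamily` /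
`interRightFamily` read through `superSite κ`. -/
def interCellMatrix (κ : TensorIndex (Fin c ×ₗ Fin W) 4 ≃ Fin Q) (hc : 0 < c) (t : ℝ) :
    Matrix (Fin Q × Fin Q) (Fin Q × Fin Q) ℂ :=
  -(t : ℂ) • ∑ y₀ : Fin W, ∑ σ : Fin 2,
    (superSite κ (productOp (interLeftFamily hc y₀ (siteCreation σ * siteParity))) ⊗ₖ
        superSite κ (productOp (interRightFamily hc y₀ (siteAnnihilation σ))) +
      superSite κ (productOp (interLeftFamily hc y₀ (siteParity * siteAnnihilation σ))) ⊗ₖ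
        superSite κ (productOp (interRightFamily hc y₀ (siteCreation σ))))

/-- **The cell bond matrix `hh` of the strip**: the intra-cell energy of the LEFT cell plus the inter-cell
coupling, `superSite κ (toSpin H_open(c × W)) ⊗ 1 + interCellMatrix κ hc t` (the strip analogue of
`cellBondMatrix` of `Upper/UMPSCellBondMatrix.lean`). -/
def stripCellBondMatrix (κ : TensorIndex (Fin c ×ₗ Fin W) 4 ≃ Fin Q) (hc : 0 < c) (t U : ℝ) :
    Matrix (Fin Q × Fin Q) (Fin Q × Fin Q) ℂ :=
  superSite κ (toSpin (hubbardOpenBoxTT' c W t 0 U)) ⊗ₖ (1 : Matrix (Fin Q) (Fin Q) ℂ) +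
    interCellMatrix κ hc t

/-- The bond sum of the inter-cell coupling over the `n + 1` bonds of the cell chain. -/
theorem bondSum_interCellMatrix (n : ℕ) (κ : TensorIndex (Fin c ×ₗ Fin W) 4 ≃ Fin Q) (hc : 0 < c) (t : ℝ) :
    (bondSum n (interCellMatrix κ hc t) : Op (Fin (n + 2)) Q) =
      -(t : ℂ) • ∑ j : Fin (n + 1), ∑ y₀ : Fin W, ∑ σ : Fin 2,
        (onSite (⟨j, by omega⟩ : Fin (n + 2))
              (superSite κ (productOp (interLeftFamily hc y₀ (siteCreation σ * siteParity)))) *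
            onSite (⟨j + 1, by omega⟩ : Fin (n + 2))
              (superSite κ (productOp (interRightFamily hc y₀ (siteAnnihilation σ)))) +
          onSite (⟨j, by omega⟩ : Fin (n + 2))
              (superSite κ (productOp (interLeftFamily hc y₀ (siteParity * siteAnnihilation σ)))) *
            onSite (⟨j + 1, by omega⟩ : Fin (n + 2))
              (superSite κ (productOp (interRightFamily hc y₀ (siteCreation σ))))) := by
  rw [interCellMatrix, bondSum_smul, bondSum_sum]
  congr 1
  simp only [bondSum_sum, bondSum_add, bondSum_kronecker, Finset.sum_add_distrib]
  congr 1 <;> exact (Finset.sum_congr rfl fun y₀ _ => Finset.sum_comm).trans Finset.sum_comm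

/-- **The strip as a chain of cells with the bond matrix `hh`** (`n + 2` cells): the blocked Hamiltonian is
the bond sum of `stripCellBondMatrix` plus the intra-cell energy of the LAST cell (not covered by a bond). -/
theorem superOp_toSpin_hubbardOpenBoxTT'_eq_bondSum (n : ℕ) (hc : 0 < c)
    (κ : TensorIndex (Fin c ×ₗ Fin W) 4 ≃ Fin Q) (t U : ℝ) :
    superOp (stripCells (n + 2) c W) κ (toSpin (hubbardOpenBoxTT' ((n + 2) * c) W t 0 U)) =
      bondSum n (stripCellBondMatrix κ hc t U) +
        onSite (Fin.last (n + 1)) (superSite κ (toSpin (hubbardOpenBoxTT' c W t 0 U))) := by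
  rw [superOp_toSpin_hubbardOpenBoxTT' hc, stripCellBondMatrix, bondSum_add, bondSum_kronecker,
    bondSum_interCellMatrix, sum_sum_ite_val_succ_eq, Fin.sum_univ_castSucc]
  simp only [onSite_one', mul_one]
  have hcast : ∀ j : Fin (n + 1), (Fin.castSucc j : Fin (n + 2)) = ⟨j, by omega⟩ := fun j => rfl
  simp only [hcast]
  abel

end Hamiltonian

end Summit.Ventures.CertifiedManyBodySolver.Upper

end
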